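import Literature.NumberTheory.GaloisRepresentations.PstWeilDeligneCrystallineDetOnInertia
import Literature.NumberTheory.GaloisRepresentations.ResidualGaloisRep
import Literature.NumberTheory.GaloisRepresentations.ModPGaloisRep
import Literature.NumberTheory.GaloisRepresentations.RamificationFiltration
import HarnessLib

/-!
# The clause "reductions of Fontaine–Laffaille crystalline representations" (degree-one base)
# for `p`-adic Hodge data — candidate clause (F13) of `IsFontaineDatum`

Topic `Literature/NumberTheory/GaloisRepresentations`; companion of the accepted clause predicates
`PstWeilDeligneData.CrystallineDetOnInertia` ((F12)), `CyclotomicPowersLabelledWeights` ((F11)),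
`IsCrystallineFramed` ((F4)) and of `Literature.NumberTheory.PAdicHodge.FontaineDpst` (the
specification `IsFontaineDatum` of Fontaine's pinned datum `(B_dR(K), WD ∘ D_pst)` and its "Upgrade
path": literature seats may ADD clauses that are theorems for the genuine datum).  This file does
not import `FontaineDpst` (it is meant to be imported BY it).

## Mathematics (Fontaine–Laffaille theory, consequence form)

Let `K/ℚ_p` be OF DEGREE ONE (`K = ℚ_p`), `ρ : Γ_K → GL_n(ℚ̄_p)` CRYSTALLINE with labelled
Hodge–Tate weights `H` (a multiset of `n` integers at the unique label, convention
`HT(ε) = {-1}`) contained in an interval `[w₀, w₀ + p − 2]`, and `ρ̄ : Γ_K → GL_n(ℤ̄_p/𝔪)` the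
reduction of ANY `Γ_K`-stable lattice.  Fontaine–Laffaille theory ([FL82]; in the covariant
normalisation of Clozel–Harris–Taylor §2.4.1 / Barnet-Lamb–Gee–Geraghty–Taylor §1.4) attaches to
`ρ̄` an object `M` of the abelian category `MF_k` of Fontaine–Laffaille modules with
`ρ̄ ≅ G_K(M)`, `FL(M) = H` (after the twist by `w₀`): "There is an exact, fully faithful, covariant
functor of `𝒪`-linear categories `G_K : MF_𝒪 → Rep_𝒪(G_K)`.  The essential image of `G_K` is
closed under taking sub-objects and quotients. … `HT_τ(G_K(M) ⊗ ℚ_l) = FL_τ(M ⊗ F)`.  Moreover, if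
`Λ` is a `G_K`-invariant lattice in a crystalline representation `V` of `G_K` with all its
Hodge–Tate numbers in the range `[0, l−2]` then `Λ` is in the image of `G_K`" (BLGGT §1.4, before
Lemma 1.4.2, citing [FL82]; verbatim also CHT §2.4.1 p. 33–34, GHLS §2.3).  Two consequences are
recorded by this clause:

(i) **Tame inertia weights = Hodge–Tate weights.**  The simple objects of `MF_k` are the
`M(h; i)`, `i : ℤ/hℤ → ℤ` of exact period `h` (FL82 Prop. 4.4), on which tame inertia acts through
the fundamental character of level `h`: "on a `g u = χ_h(g)^{i_0 + q i_1 + ⋯ + q^{h−1} i_{h−1}} · u`"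
(FL82 Thm. 5.3 (iii), p. 570; §0.8: the §5 results "donne[nt] l'action de l'inertie modérée, i.e.
l'action de `G` sur les semi-simplifiées des réductions modulo `π`"; rank one: Breuil's /
BDJ Lemma 3.8 "`ψ̄|_I = ∏ ω_τ^{m_τ}`").  Hence `ρ̄|_{I_K}` is triangularisable with diagonal the tame
characters `ω_{h_B}^{−(d^B_j + q d^B_{j+1} + ⋯ + q^{h_B−1} d^B_{j+h_B−1})}` (indices mod `h_B`)
attached to BLOCKS `B = (h_B, d^B)` whose digits `d^B_m` together form the multiset `H` — in the
covariant convention `HT(ε) = −1` the rank-one object of weight `w` is `unr ⊗ ε^{−w}`, residually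
`ω^{−w}` on inertia (sign checked on `n = 1` and on the dual of the Tate module of a supersingular
elliptic curve: weights `{0,1}`, `E[p](−1)|_I = ω₂^{−1} ⊕ ω₂^{−p}`).

(ii) **Rank-two subquotients: ordering and peu ramifié.**  A `Γ_K`-subquotient of `ρ̄` of
dimension `2` which is a NON-SPLIT extension of a character with inertial restriction `ω^{−a}`
(quotient) by one with inertial restriction `ω^{−b}` (sub), `a, b ∈ H`, is `G_K` of a non-split
extension in `MF_k` of the rank-one objects of weights `a`, `b` (essential image closed under
subquotients; `G_K` fully faithful), so `Ext¹_{MF_k}(M_a, N_b) ≠ 0`, which by CHT Lemma 2.4.2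
("`0 → Hom_{MF}(M,N) → Fil⁰ Hom(M,N) → Hom_{Fr⊗1}(gr M, N) → Ext¹_{MF}(M,N) → 0`") forces
`b < a` (the SUB has the smaller Hodge–Tate weight; for weights `{0, 1}` over `ℚ_p` this is
Conrad's form of Raynaud's theorem on flat representations: "If `ρ̄` is reducible, then
`ρ̄ ≃ (ω χ̄₁ ∗; 0 χ̄₂)` with `χ̄_i` unramified", CSS 1997 Thm. 1.8 (i)); and when `a = b + 1` the
extension class is PEU RAMIFIÉE (Gee–Herzig–Liu–Savitt Prop. 2.3.1: "Suppose that `r̄` admits a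
Fontaine–Laffaille lift. Then … `r̄` is peu ramifiée" with Examples 2.1.4 (1): for `n = 2`,
`r̄ ≅ (χ ω ∗; 0 χ)`, "coincides with the usual definition of peu ramifiée"; Serre 1987 §2.4 (ii),
§2.8 Prop. 4: finite flat ⇔ peu ramifié), phrased with the tree's `IsPeuRamifie` convention: the
upper ramification groups `I_K^v`, `v > 1`, act trivially on the subquotient.

Degenerate checks: `ρ` unramified (all weights `0`, `H = {0,…,0}`: blocks `(1, 0)`, characters
trivial — consistent with (F3)); `ρ = ε^m` (`H = {−m}` by (F11): block `(1, −m)`, character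
`ω^{m}` = `ε^m` on inertia residually — consistent); `n = 0`.

WHY DEGREE ONE ONLY.  For `K/ℚ_p` unramified of degree `f > 1` the inertial weights are indexed by
the `f` embeddings with fundamental characters of level `f h` (GHLS §2.3, BDJ §3), a normalisation
the tree does not yet fix; as (F12), the clause is vacuous (harmless) when `[K : ℚ_p] > 1`.
-- TODO(general form): unramified `K/ℚ_p`, labelled digits `ω_{σ}` per embedding (BDJ Lemma 3.8,
-- GHLS Prop. 2.3.1 for all unramified `K`).

## Why a clause (and not a theorem about `fontainePst`)

No clause among (F1)–(F12) constrains the reduction of a `𝔇`-crystalline representation of rank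
`n ≥ 2` (docstring of `FontaineDpst`: "a statement about `fontainePst` is provable exactly when it
holds for EVERY datum satisfying the clauses").  Requested by crux `stmt-Langlands-16779`
(`RamifiedCoefficientSeed.AdjointLiftingGL3`, line `birth`, stub `stub_localFL`): the Serre weight
of the two-dimensional seed `ρ̄₀` must be read off the reduction of the THREE-dimensional crystalline
`ρ ≅ η ⊗ ad⁰ ρ₀` of weights `{0,1,2}` at the pinned datum of `ℚ_v`, `v ∣ p` — exactly (i) (digits:
`η̄|_I = ω⁻¹`, projective inertia order of `ρ̄₀`) and (ii) (the `2`-dimensional sub-quotients of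
`η̄ ⊗ ad⁰ ρ̄₀`: wrong order ⇒ split, consecutive ⇒ peu ramifié ⇒ `k(ρ̄₀ ⊗ ω^{-s}) = 2`).

## What this file provides (no `sorry`, no named fact)

* `flBlockCharacters K ι ϖ hϖ B` — the multiset of tame inertia characters of a list of blocks
  `B : List (Σ h, Fin h → ℤ)` (level-`h` fundamental character of the accepted `fundamentalCharacter`,
  exponent `−Σ_m d((j+m) mod h) q^m`, `q = residueFieldCard K`);
* `flBlockDigits B` — the multiset of all digits;
* `PstWeilDeligneData.FontaineLaffailleReductions 𝔇` — **the clause** ((i) ∧ (ii) above, for every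
  `n`, `ρ`, label, `w₀`, every reduction `ρ̄` of `ρ` over `ℤ̄_p/𝔪` along `RingHom.id`
  (`FramedGaloisRep.IsReductionOf`), every residue embedding `ι` and uniformiser `ϖ`).
The verification that the truncated datum `K̂_nr` satisfies the clause (there crystalline =
unramified, weights `0`) is left to the `FontaineDpst` integration step.

## References

* [FontaineLaffaille1982] J.-M. Fontaine, G. Laffaille, *Construction de représentations
  `p`-adiques*, Ann. Sci. ÉNS 15 (1982): §0.8, Prop. 4.4, Thm. 5.3 (p. 570), Thm. 6.1, §9.11–9.12.
* [ClozelHarrisTaylor2008] L. Clozel, M. Harris, R. Taylor, Publ. Math. IHÉS 108 (2008), §2.4.1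
  (p. 33–34), Lemma 2.4.2 (p. 35).
* [BarnetlambEtAl2014] T. Barnet-Lamb, T. Gee, D. Geraghty, R. Taylor, Ann. of Math. 179 (2014),
  §1.4 (before Lemma 1.4.2); Notation (`HT_τ(ε_l) = {−1}`).
* [GeeHerzigLiuSavitt2017] T. Gee, F. Herzig, T. Liu, D. Savitt, Doc. Math. 22 (2017), §2.3,
  Prop. 2.3.1, Def. 2.1.2, Examples 2.1.4.
* [Conrad1997Flat] B. Conrad, *The flat deformation functor*, in Cornell–Silverman–Stevens (1997),
  Thm. 1.7, Thm. 1.8.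
* [Serre1987] J.-P. Serre, Duke Math. J. 54 (1987), §2.4, §2.8 Prop. 4.
-/

noncomputable section

open scoped MatrixGroups Valued
open Field ValuativeRel

namespace Literature.NumberTheory.GaloisRepresentations

open GaloisRepresentations.IsNonarchimedeanLocalField

section Blocks

variable (K : Type) [Field K] [ValuativeRel K] [TopologicalSpace K] [IsNonarchimedeanLocalField K]
  {k : Type*} [Field k]

/-- **The tame inertia characters of a Fontaine–Laffaille block.**  A block is a level `h ≥ 1`
with digits `d : Fin h → ℤ`; its characters are, for `j : Fin h`,
`ψ_h ^ (−Σ_{m} d((j + m) mod h) · q^m)` where `ψ_h = fundamentalCharacter K h ι ϖ hϖ` is the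
level-`h` fundamental character of `I_K` and `q = #𝓀[K]` (FL82 Thm. 5.3 (iii):
`χ_h^{i_0 + q i_1 + ⋯ + q^{h−1} i_{h−1}}`; the sign is that of the covariant convention
`HT(ε) = −1`, rank one: weight `w ↦ ω^{−w}`); the `h` characters of a block are the
`Gal(𝔽_{q^h}/𝔽_q)`-conjugates of one another.  For a list of blocks, the multiset sum.
[cite: FontaineLaffaille1982, Thm. 5.3 (iii) (p. 570) and Prop. 4.4] -/
def flBlockCharacters (ι : absIntegers 𝒪[K] K ⧸ absMaximalIdeal K →+* k) (ϖ : 𝒪[K])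
    (hϖ : Irreducible ϖ) (B : List (Σ h : ℕ, Fin h → ℤ)) : Multiset (↥(absInertia K) →* kˣ) :=
  (B.map fun b => (Finset.univ : Finset (Fin b.1)).val.map fun j =>
    (fundamentalCharacter K b.1 ι ϖ hϖ) ^
      (-(∑ m : Fin b.1, b.2 ⟨(j.val + m.val) % b.1, Nat.mod_lt _ (Fin.pos j)⟩ *
        ((residueFieldCard K : ℤ) ^ m.val)))).sum

/-- **The digits of a list of Fontaine–Laffaille blocks**, as a multiset of integers (to be
compared with the multiset of labelled Hodge–Tate weights). [cite: FontaineLaffaille1982, Prop. 4.4] -/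
def flBlockDigits (B : List (Σ h : ℕ, Fin h → ℤ)) : Multiset ℤ :=
  (B.map fun b => (Finset.univ : Finset (Fin b.1)).val.map b.2).sum

/-- The `2 × 2` block of an `n × n` matrix at rows/columns `i, i + 1`. [folklore] -/
def middleBlock {R : Type*} {n : ℕ} (M : Matrix (Fin n) (Fin n) R) (i : ℕ) (hi : i + 1 < n) :
    Matrix (Fin 2) (Fin 2) R :=
  Matrix.of fun r c : Fin 2 => M ⟨i + r.val, by omega⟩ ⟨i + c.val, by omega⟩

end Blocks

section Pst

variable {K : Type} [Field K] [ValuativeRel K] [TopologicalSpace K] [IsNonarchimedeanLocalField K]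
  {p : ℕ} [Fact p.Prime]

namespace PstWeilDeligneData

/-- **Clause (F13): reductions of Fontaine–Laffaille crystalline representations (degree-one
base).**  For the `p`-adic Hodge datum `𝔇` of `K` (intended: Fontaine's `(B_dR(K), WD ∘ D_pst)`):
IF the datum's own `ℚ_p`-structure makes `ℚ_p → K` surjective (degree one), THEN for every `n`,
every framed `ρ : Γ_K →ₜ* GL_n(ℚ̄_p)` which is `𝔇`-crystalline, every `ℚ_p`-embedding `τ` (the
unique label), every `w₀ : ℤ` such that all labelled Hodge–Tate weights
`H = 𝔇.𝔅.labelledHodgeTateWeights ρ τ` lie in `[w₀, w₀ + p − 2]`, every reduction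
`ρ̄ : Γ_K → GL_n(ℤ̄_p/𝔪)` of `ρ` (any lattice; `FramedGaloisRep.IsReductionOf` along
`RingHom.id`), every residue embedding `ι` and uniformiser `ϖ`:
(i) (**tame inertia weights**) there are blocks `B` with digit multiset `H`, a change of basis
`P ∈ GL_n` and a diagonal of characters `d` enumerating the block characters, such that
`P ρ̄(σ) P⁻¹` is upper triangular with diagonal `d(σ)` for every `σ ∈ I_K`;
(ii) (**rank-two subquotients**) for every change of basis `P`, index `i` and `a, b ∈ H`: if
`P ρ̄ P⁻¹` is block upper triangular on `Γ_K` for the partition `{< i} ∪ {i, i+1} ∪ {> i+1}` with the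
middle `2 × 2` block upper triangular on `Γ_K`, with inertial diagonal `(ω^{−b}, ω^{−a})`
(`ω = ψ_1`), and the middle block is NOT diagonalisable on `Γ_K` (non-split), then `b < a`, and if
moreover `a = b + 1` the middle block is trivial on every upper ramification group `I_K^v`, `v > 1`
(peu ramifié, the convention of the accepted `ModPGaloisRep.IsPeuRamifie`).
TRUE for the genuine datum by Fontaine–Laffaille theory in the covariant normalisation (BLGGT §1.4
/ CHT §2.4.1: any lattice in a crystalline representation with weights in `[0, p−2]` is `G_K(M)`,
essential image closed under subquotients, `HT = FL`; FL82 Prop. 4.4 and Thm. 5.3 (iii) for (i);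
CHT Lemma 2.4.2 and GHLS Prop. 2.3.1 with Examples 2.1.4 (1) for (ii); for the `D_pst` phrasing of
"crystalline", Fontaine 1994, Exp. VIII §2.3.7).  Vacuous when `[K : ℚ_p] > 1`.
[cite: FontaineLaffaille1982, Prop. 4.4 and Thm. 5.3 (iii) (p. 570)]
[cite: ClozelHarrisTaylor2008, §2.4.1 (p. 33–34) and Lemma 2.4.2 (p. 35)]
[cite: BarnetlambEtAl2014, §1.4 (before Lemma 1.4.2)]
[cite: GeeHerzigLiuSavitt2017, Prop. 2.3.1, Def. 2.1.2 and Examples 2.1.4 (1)]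
[cite: Conrad1997Flat, Thm. 1.8 (i)] -/
def FontaineLaffailleReductions (𝔇 : PstWeilDeligneData K p) : Prop :=
  letI := 𝔇.algebra
  Function.Surjective (algebraMap ℚ_[p] K) →
    ∀ {n : ℕ} (ρ : FramedGaloisRep K (PadicAlgCl p) n) (τ : K →ₐ[ℚ_[p]] PadicAlgCl p) (w₀ : ℤ),
      𝔇.IsCrystallineFramed ρ →
      (∀ x ∈ 𝔇.𝔅.labelledHodgeTateWeights ρ.toGaloisRep τ.toRingHom, w₀ ≤ x ∧ x ≤ w₀ + (p - 2 : ℕ)) →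
      ∀ (ρb : absoluteGaloisGroup K →* GL (Fin n) (padicAlgClResidueField p)),
        ρ.IsReductionOf (RingHom.id _) ρb →
        ∀ (ι : absIntegers 𝒪[K] K ⧸ absMaximalIdeal K →+* padicAlgClResidueField p) (ϖ : 𝒪[K])
          (hϖ : Irreducible ϖ),
          -- (i) tame inertia weights = Hodge–Tate weights
          (∃ (B : List (Σ h : ℕ, Fin h → ℤ)) (P : GL (Fin n) (padicAlgClResidueField p))
              (d : Fin n → (↥(absInertia K) →* (padicAlgClResidueField p)ˣ)),
              flBlockDigits B = 𝔇.𝔅.labelledHodgeTateWeights ρ.toGaloisRep τ.toRingHom ∧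
              (Finset.univ : Finset (Fin n)).val.map d = flBlockCharacters K ι ϖ hϖ B ∧
              ∀ σ : ↥(absInertia K), ∀ i j : Fin n,
                (j < i → ((P * ρb (σ : absoluteGaloisGroup K) * P⁻¹ : GL (Fin n) _) :
                  Matrix (Fin n) (Fin n) (padicAlgClResidueField p)) i j = 0) ∧
                (((P * ρb (σ : absoluteGaloisGroup K) * P⁻¹ : GL (Fin n) _) :
                  Matrix (Fin n) (Fin n) (padicAlgClResidueField p)) i i = ((d i σ : _ˣ) : _))) ∧
          -- (ii) rank-two subquotients: ordering and peu ramifié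
          (∀ (P : GL (Fin n) (padicAlgClResidueField p)) (i : ℕ) (hi : i + 1 < n) (a b : ℤ),
              a ∈ 𝔇.𝔅.labelledHodgeTateWeights ρ.toGaloisRep τ.toRingHom →
              b ∈ 𝔇.𝔅.labelledHodgeTateWeights ρ.toGaloisRep τ.toRingHom →
              -- block upper triangular on `Γ_K` for `{< i} ∪ {i, i+1} ∪ {> i+1}`, middle block
              -- upper triangular
              (∀ (σ : absoluteGaloisGroup K) (r c : Fin n),
                  ((i ≤ r.val ∧ c.val < i) ∨ (i + 2 ≤ r.val ∧ c.val < i + 2) ∨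
                      (r.val = i + 1 ∧ c.val = i)) →
                    ((P * ρb σ * P⁻¹ : GL (Fin n) _) :
                      Matrix (Fin n) (Fin n) (padicAlgClResidueField p)) r c = 0) →
              -- inertial diagonal `(ω^{-b}, ω^{-a})` of the middle block
              (∀ σ : ↥(absInertia K),
                  ((P * ρb (σ : absoluteGaloisGroup K) * P⁻¹ : GL (Fin n) _) :
                      Matrix (Fin n) (Fin n) (padicAlgClResidueField p)) ⟨i, by omega⟩ ⟨i, by omega⟩ =
                    (((fundamentalCharacter K 1 ι ϖ hϖ) ^ (-b)) σ : _ˣ) ∧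
                  ((P * ρb (σ : absoluteGaloisGroup K) * P⁻¹ : GL (Fin n) _) :
                      Matrix (Fin n) (Fin n) (padicAlgClResidueField p)) ⟨i + 1, hi⟩ ⟨i + 1, hi⟩ =
                    (((fundamentalCharacter K 1 ι ϖ hϖ) ^ (-a)) σ : _ˣ)) →
              -- non-split: the middle block is not diagonalisable on `Γ_K`
              (¬ ∃ Q : GL (Fin 2) (padicAlgClResidueField p), ∀ (σ : absoluteGaloisGroup K) (r c : Fin 2),
                  r ≠ c →
                    ((Q : Matrix (Fin 2) (Fin 2) (padicAlgClResidueField p)) *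
                        middleBlock (((P * ρb σ * P⁻¹ : GL (Fin n) _) :
                          Matrix (Fin n) (Fin n) (padicAlgClResidueField p))) i hi *
                        ((Q⁻¹ : GL (Fin 2) (padicAlgClResidueField p)) :
                          Matrix (Fin 2) (Fin 2) (padicAlgClResidueField p))) r c = 0) →
              b < a ∧
                (a = b + 1 → ∀ v : ℝ, 1 < v → ∀ σ ∈ absUpperInertia K v,
                  middleBlock (((P * ρb σ * P⁻¹ : GL (Fin n) _) :
                    Matrix (Fin n) (Fin n) (padicAlgClResidueField p))) i hi = 1))

end PstWeilDeligneData

end Pst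

end Literature.NumberTheory.GaloisRepresentations

end
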